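import Mathlib
import Summits.Ventures.PercRepro2.Defs
import Summits.Ventures.PercRepro2.Graph
import Summits.Ventures.PercRepro2.OneColourSwitch
import Summits.Ventures.PercRepro2.RegionHubSign
import Summits.Ventures.PercRepro2.SideSwitch
import Summits.Ventures.PercRepro2.TermSwitchDefs
import Summits.Ventures.PercRepro2.TermSwitchFibre
import Summits.Ventures.PercRepro2.TermSwitchMono
import Summits.Ventures.PercRepro2.TermSwitchM9
import Summits.Ventures.PercRepro2.TermSwitchRestrict
import Summits.Ventures.PercRepro2.TermSwitchReach
import Summits.Ventures.PercRepro2.M9NoPocketDefs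
import Summits.Ventures.PercRepro2.M9Unreached

/-!
# The general single-`d` statement reduces to the hub–dead-end sum (blind cell PercRepro2,
p3 g25, 2026-08-28; `proofs/P3-GENERALD.md` §2)

For ANY non-mark `d`, the `Sep ∧ DOne` colourings split into three classes by the status of `d`
with respect to the worlds of `{r, s}` and of the terminal set `H = {r, s, d}`:

* `N`: `d` unreached (`d ∉ K₂ ∪ M₂`) — `unreachedSum`, non-positive (`M9Unreached`);
* `L`: `d` reached and the colouring is `Sep_H ∧ DZero_H` for `H = {r, s, d}` (the doubly
  reached colourings together with the «clean» one-sided ones) — the restricted three-terminal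
  sum `dzeroSignSumHP … (Reached)`, non-positive (`TermSwitchReach`);
* `HD`: `d` reached in one colour only, with the other-colour cluster of `d` touching `p`, `q`
  (a hub) or a vertex of the world of `{r, s}` other than `r, s, d` (a dead end) — `hdSum`.

The identity `dSignSum = unreachedSum + dzeroSignSumHP (Reached) + hdSum`
(`dSignSum_eq_unreached_add_reached_add_hd`) is a pointwise partition, using only
`Sep_H ⇒ Sep` and `DZero_H ⇒ DOne` for `H ⊇ {r, s}`.  Hence `dSignSum ≤ hdSum`
(`dSignSum_le_hdSum`) and the general single-`d` statement follows from `hdSum ≤ 0`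
(`dSignSum_nonpos_of_hdSum_nonpos`) — a statement about `Sep ∧ DZero` colourings only
(`hd_iff_dzero`: the `HD` colourings have no doubly reached vertex at all).  Own work; std
axioms.
-/

namespace Summit.Ventures.PercRepro2

namespace NoPocket

open Finset Classical RegionHub OneColourSwitch SideSwitch TermSwitch

variable {V : Type*} {E : Type*}

section Pointwise

variable {ends : E → Sym2 V} {p q r s d : V}

/-- `Sep_H` for `H = {r, s, d}` gives the two-colour separation `Sep`. -/
lemma sep2_of_sepH_triple {ω : Config E} (h : sepH ends p q ({r, s, d} : Set V) ω) :
    sep2 ends p q r s ω :=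
  sep2_of_sepH (r_mem_triple r s d) (s_mem_triple r s d) h

/-- `DZero_H` for `H = {r, s, d}` gives `DOne`: a vertex other than `r, s, d` in both worlds of
`{r, s}` would lie in both worlds of `H`. -/
lemma DOne_of_DZeroH_triple {ω : Config E} (h : DZeroH ends ({r, s, d} : Set V) ω) :
    DOne ends r s d ω := by
  intro x hxr hxs hxd hxK
  have hxH : x ∉ ({r, s, d} : Set V) := by
    simp only [Set.mem_insert_iff, Set.mem_singleton_iff, not_or]
    exact ⟨hxr, hxs, hxd⟩
  exact not_mem_both_of_DZeroH (r_mem_triple r s d) (s_mem_triple r s d) h hxH hxK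

/-- The `L`-class is inside the single-`d` family. -/
lemma sep2_and_DOne_of_L {ω : Config E}
    (h : sepH ends p q ({r, s, d} : Set V) ω ∧ DZeroH ends ({r, s, d} : Set V) ω ∧
      Reached ends r s d ω) :
    sep2 ends p q r s ω ∧ DOne ends r s d ω :=
  ⟨sep2_of_sepH_triple h.1, DOne_of_DZeroH_triple h.2.1⟩

/-- The `HD`-colourings: `Sep ∧ DOne`, `d` reached, and not `Sep_H ∧ DZero_H` for
`H = {r, s, d}`. -/
def HD (ends : E → Sym2 V) (p q r s d : V) (ω : Config E) : Prop :=
  sep2 ends p q r s ω ∧ DOne ends r s d ω ∧ Reached ends r s d ω ∧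
    ¬ (sepH ends p q ({r, s, d} : Set V) ω ∧ DZeroH ends ({r, s, d} : Set V) ω)

/-- **Pointwise partition of the single-`d` family** into `N`, `L` and `HD`: the three
indicators of a colouring sum to the indicator of `Sep ∧ DOne`. -/
lemma indicator_split (ω : Config E) :
    (if sep2 ends p q r s ω ∧ DOne ends r s d ω then
        sigma ends ω p q * sigma ends ω r s else 0) =
      (if sep2 ends p q r s ω ∧ DOne ends r s d ω ∧ d ∉ K2 ends r s ω ∧ d ∉ M2 ends r s ω then
        sigma ends ω p q * sigma ends ω r s else 0) +
      (if sepH ends p q ({r, s, d} : Set V) ω ∧ DZeroH ends ({r, s, d} : Set V) ω ∧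
          Reached ends r s d ω then sigma ends ω p q * sigma ends ω r s else 0) +
      (if HD ends p q r s d ω then sigma ends ω p q * sigma ends ω r s else 0) := by
  by_cases h0 : sep2 ends p q r s ω ∧ DOne ends r s d ω
  · rw [if_pos h0]
    by_cases hR : Reached ends r s d ω
    · have hN : ¬ (sep2 ends p q r s ω ∧ DOne ends r s d ω ∧ d ∉ K2 ends r s ω ∧
          d ∉ M2 ends r s ω) := by
        rintro ⟨_, _, hK, hM⟩
        rcases hR with h | h
        · exact hK h
        · exact hM h
      rw [if_neg hN, zero_add]
      by_cases hL : sepH ends p q ({r, s, d} : Set V) ω ∧ DZeroH ends ({r, s, d} : Set V) ω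
      · rw [if_pos ⟨hL.1, hL.2, hR⟩, if_neg (fun h => h.2.2.2 hL), add_zero]
      · rw [if_neg (fun h => hL ⟨h.1, h.2.1⟩), if_pos ⟨h0.1, h0.2, hR, hL⟩, zero_add]
    · have hN : sep2 ends p q r s ω ∧ DOne ends r s d ω ∧ d ∉ K2 ends r s ω ∧
          d ∉ M2 ends r s ω :=
        ⟨h0.1, h0.2, fun h => hR (Or.inl h), fun h => hR (Or.inr h)⟩
      rw [if_pos hN, if_neg (fun h => hR h.2.2), if_neg (fun h => hR h.2.2.1), add_zero,
        add_zero]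
  · rw [if_neg h0, if_neg (fun h => h0 ⟨h.1, h.2.1⟩),
      if_neg (fun h => h0 (sep2_and_DOne_of_L h)), if_neg (fun h => h0 ⟨h.1, h.2.1⟩)]
    simp

end Pointwise

section Sum

variable [Fintype V] [DecidableEq V] [Fintype E] [DecidableEq E] {ends : E → Sym2 V}
  {p q r s d : V}

/-- The hub–dead-end sum: `Σ_{HD} σ_pq · σ_rs`. -/
noncomputable def hdSum (ends : E → Sym2 V) (p q r s d : V) : ℤ :=
  ∑ ω : Config E, if HD ends p q r s d ω then sigma ends ω p q * sigma ends ω r s else 0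

omit [Fintype V] [DecidableEq V] in
/-- **The status decomposition of the single-`d` sum**:
`dSignSum = unreachedSum + dzeroSignSumHP {r, s, d} (Reached) + hdSum`. -/
theorem dSignSum_eq_unreached_add_reached_add_hd :
    dSignSum ends p q r s d = unreachedSum ends p q r s d +
      dzeroSignSumHP ends p q r s ({r, s, d} : Set V) (Reached ends r s d) +
      hdSum ends p q r s d := by
  unfold dSignSum unreachedSum dzeroSignSumHP hdSum
  rw [← Finset.sum_add_distrib, ← Finset.sum_add_distrib]
  exact Finset.sum_congr rfl fun ω _ => indicator_split ω

/-- **The general single-`d` statement reduces to the hub–dead-end sum**: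
`dSignSum ≤ hdSum` for every non-mark `d` (the unreached part and the three-terminal part are
non-positive). -/
theorem dSignSum_le_hdSum (hrd : r ≠ d) (hsd : s ≠ d) :
    dSignSum ends p q r s d ≤ hdSum ends p q r s d := by
  rw [dSignSum_eq_unreached_add_reached_add_hd]
  have h1 := unreachedSum_nonpos (ends := ends) (p := p) (q := q) (r := r) (s := s) (d := d)
  have h2 := dzeroSignSumHP_reached_nonpos (ends := ends) p q hrd hsd
  linarith

/-- The general single-`d` statement follows from `hdSum ≤ 0`. -/
theorem dSignSum_nonpos_of_hdSum_nonpos (hrd : r ≠ d) (hsd : s ≠ d)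
    (h : hdSum ends p q r s d ≤ 0) : dSignSum ends p q r s d ≤ 0 :=
  (dSignSum_le_hdSum hrd hsd).trans h

end Sum

section Characterisation

variable {ends : E → Sym2 V} {p q r s d : V}

/-- The `Y`-world of `{r, s, d}` is the `Y`-world of `{r, s}` together with the `Y`-cluster of
`d`. -/
lemma mem_KH_triple' {ω : Config E} {x : V} :
    x ∈ KH ends ({r, s, d} : Set V) ω ↔ x ∈ K2 ends r s ω ∨ Conn ends ω d x := by
  simp only [mem_KH_iff, mem_K2_iff, Set.mem_insert_iff, Set.mem_singleton_iff]
  constructor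
  · rintro ⟨h, (rfl | rfl | rfl), hc⟩
    · exact Or.inl (Or.inl hc)
    · exact Or.inl (Or.inr hc)
    · exact Or.inr hc
  · rintro ((hc | hc) | hc)
    · exact ⟨r, Or.inl rfl, hc⟩
    · exact ⟨s, Or.inr (Or.inl rfl), hc⟩
    · exact ⟨d, Or.inr (Or.inr rfl), hc⟩

/-- The `W`-world of `{r, s, d}` is the `W`-world of `{r, s}` together with the `W`-cluster of
`d`. -/
lemma mem_MH_triple' {ω : Config E} {x : V} :
    x ∈ MH ends ({r, s, d} : Set V) ω ↔
      x ∈ M2 ends r s ω ∨ Conn ends (OneColourSwitch.compl ω) d x :=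
  mem_KH_triple' (ω := OneColourSwitch.compl ω)

/-- A doubly reached `d` is `Sep_H ∧ DZero_H` as soon as the colouring is `Sep ∧ DOne`: the
worlds of `H` are then the worlds of `{r, s}`. -/
lemma L_of_mem_both {ω : Config E} (hsep : sep2 ends p q r s ω) (hD : DOne ends r s d ω)
    (hK : d ∈ K2 ends r s ω) (hM : d ∈ M2 ends r s ω) :
    sepH ends p q ({r, s, d} : Set V) ω ∧ DZeroH ends ({r, s, d} : Set V) ω := by
  have hKH : ∀ x, x ∈ KH ends ({r, s, d} : Set V) ω ↔ x ∈ K2 ends r s ω := by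
    intro x
    rw [mem_KH_triple']
    constructor
    · rintro (h | h)
      · exact h
      · rw [mem_K2_iff] at hK ⊢
        rcases hK with hK | hK
        · exact Or.inl (conn_trans hK h)
        · exact Or.inr (conn_trans hK h)
    · exact Or.inl
  have hMH : ∀ x, x ∈ MH ends ({r, s, d} : Set V) ω ↔ x ∈ M2 ends r s ω := by
    intro x
    rw [mem_MH_triple']
    constructor
    · rintro (h | h)
      · exact h
      · rw [mem_M2_iff] at hM ⊢
        rcases hM with hM | hM
        · exact Or.inl (conn_trans hM h)
        · exact Or.inr (conn_trans hM h)
    · exact Or.inl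
  obtain ⟨⟨hpr, hps, hqr, hqs⟩, ⟨hpr', hps', hqr', hqs'⟩⟩ := hsep
  refine ⟨⟨?_, ?_, ?_, ?_⟩, ?_⟩
  · rw [hKH, mem_K2_iff]
    rintro (h | h)
    · exact hpr (conn_symm h)
    · exact hps (conn_symm h)
  · rw [hKH, mem_K2_iff]
    rintro (h | h)
    · exact hqr (conn_symm h)
    · exact hqs (conn_symm h)
  · rw [hMH, mem_M2_iff]
    rintro (h | h)
    · exact hpr' (conn_symm h)
    · exact hps' (conn_symm h)
  · rw [hMH, mem_M2_iff]
    rintro (h | h)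
    · exact hqr' (conn_symm h)
    · exact hqs' (conn_symm h)
  · intro x hxH hxK hxM
    rw [hKH] at hxK
    rw [hMH] at hxM
    simp only [Set.mem_insert_iff, Set.mem_singleton_iff, not_or] at hxH
    exact hD x hxH.1 hxH.2.1 hxH.2.2 hxK hxM

/-- **The `HD`-colourings have no doubly reached vertex at all**: they are `Sep ∧ DZero`
colourings with `d` reached in exactly one colour. -/
lemma hd_iff_dzero {ω : Config E} :
    HD ends p q r s d ω ↔
      sep2 ends p q r s ω ∧ DZero ends r s ω ∧
        ((d ∈ K2 ends r s ω ∧ d ∉ M2 ends r s ω) ∨ (d ∈ M2 ends r s ω ∧ d ∉ K2 ends r s ω)) ∧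
        ¬ (sepH ends p q ({r, s, d} : Set V) ω ∧ DZeroH ends ({r, s, d} : Set V) ω) := by
  constructor
  · rintro ⟨hsep, hD, hR, hL⟩
    have hone : ¬ (d ∈ K2 ends r s ω ∧ d ∈ M2 ends r s ω) :=
      fun h => hL (L_of_mem_both hsep hD h.1 h.2)
    refine ⟨hsep, ?_, ?_, hL⟩
    · intro x hxr hxs hxK hxM
      by_cases hxd : x = d
      · subst hxd
        exact hone ⟨hxK, hxM⟩
      · exact hD x hxr hxs hxd hxK hxM
    · rcases hR with h | h
      · exact Or.inl ⟨h, fun h' => hone ⟨h, h'⟩⟩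
      · exact Or.inr ⟨h, fun h' => hone ⟨h', h⟩⟩
  · rintro ⟨hsep, hD, hone, hL⟩
    refine ⟨hsep, fun x hxr hxs _ hxK => hD x hxr hxs hxK, ?_, hL⟩
    rcases hone with h | h
    · exact Or.inl h.1
    · exact Or.inr h.1

/-- The defect of an `HD`-colouring with `d` in the `Y`-world: the `W`-cluster of `d` contains
`p`, `q`, or a vertex of `K₂` other than `r, s, d` (a hub or a dead end); the mirror statement
for `d ∈ M₂` is the colour flip. -/
lemma hub_or_dead_of_HD_K {ω : Config E} (h : HD ends p q r s d ω) (hK : d ∈ K2 ends r s ω) :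
    Conn ends (OneColourSwitch.compl ω) d p ∨ Conn ends (OneColourSwitch.compl ω) d q ∨
      ∃ x, x ≠ r ∧ x ≠ s ∧ x ≠ d ∧ x ∈ K2 ends r s ω ∧
        Conn ends (OneColourSwitch.compl ω) d x := by
  obtain ⟨hsep, hD, _, hL⟩ := h
  by_contra hcon
  simp only [not_or, not_exists, not_and] at hcon
  obtain ⟨hp, hq, hx⟩ := hcon
  apply hL
  have hKH : ∀ x, x ∈ KH ends ({r, s, d} : Set V) ω ↔ x ∈ K2 ends r s ω := by
    intro x
    rw [mem_KH_triple']
    constructor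
    · rintro (h | h)
      · exact h
      · rw [mem_K2_iff] at hK ⊢
        rcases hK with hK | hK
        · exact Or.inl (conn_trans hK h)
        · exact Or.inr (conn_trans hK h)
    · exact Or.inl
  obtain ⟨⟨hpr, hps, hqr, hqs⟩, ⟨hpr', hps', hqr', hqs'⟩⟩ := hsep
  refine ⟨⟨?_, ?_, ?_, ?_⟩, ?_⟩
  · rw [hKH, mem_K2_iff]
    rintro (h' | h')
    · exact hpr (conn_symm h')
    · exact hps (conn_symm h')
  · rw [hKH, mem_K2_iff]
    rintro (h' | h')
    · exact hqr (conn_symm h')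
    · exact hqs (conn_symm h')
  · rw [mem_MH_triple', mem_M2_iff]
    rintro ((h' | h') | h')
    · exact hpr' (conn_symm h')
    · exact hps' (conn_symm h')
    · exact hp h'
  · rw [mem_MH_triple', mem_M2_iff]
    rintro ((h' | h') | h')
    · exact hqr' (conn_symm h')
    · exact hqs' (conn_symm h')
    · exact hq h'
  · intro x hxH hxK hxM
    rw [hKH] at hxK
    rw [mem_MH_triple'] at hxM
    simp only [Set.mem_insert_iff, Set.mem_singleton_iff, not_or] at hxH
    rcases hxM with hxM | hxM
    · exact hD x hxH.1 hxH.2.1 hxH.2.2 hxK hxM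
    · exact hx x hxH.1 hxH.2.1 hxH.2.2 hxK hxM

end Characterisation

end NoPocket

end Summit.Ventures.PercRepro2
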